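import Mathlib
import Literature.NumberTheory.LFunctions.Zhang2022.TypedSection15AIdentities
import Literature.NumberTheory.LFunctions.Zhang2022.Section4StatementsHolds2
import Literature.NumberTheory.LFunctions.Zhang2022.Section5Lemma51
import Literature.NumberTheory.LFunctions.Zhang2022.Section13U007bTools
import Literature.NumberTheory.LFunctions.Zhang2022.Section2FunctionalEquation
import Literature.NumberTheory.LFunctions.Zhang2022.SkeletonWindowPowers
import HarnessLib

/-!
# Zhang (2022), §15 p. 80: the gamma-factor steps `Z22:§15.u006` and `Z22:§15.u004` of the proof of (15.4), kernel-checked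

Topic `Literature/NumberTheory/LFunctions/Zhang2022` (Landau–Siegel audit tree; verdict-neutral).
Y. Zhang, *Discrete mean estimates and the Landau–Siegel zero*, arXiv:2211.02515v1 (2022)
[Zhang2022LandauSiegel] — **an unrefereed manuscript under adjudication; nothing here asserts or denies
its Theorems 1–2.** Lane ZHANG-L (discharge of the typed §15 nodes feeding the leaf `Typed.Section15A.Eq15_6`).

§15 p. 80 (tex L4021–L4027), inside the proof of (15.4) "`Σ_{ψ∈Ψ₁} I₂⁻(ψ) = o(𝔓)`":

> On the other hand, by (2.4), (2.5) and the relation `τ(χψ) = τ(χ)τ(ψ)ψ(D)χ(p)`, we have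
> `Z(s,ψ)/Z(s,χψ) = τ(χ)χ(p)ψ̄(D)D^{s−1}(1 + O(e^{−πt}))`.

This file PROVES the typed node `Typed.Section15A.Step15_u006` BY NAME (`step15_u006_holds`), with the
constant `15`, for every `D ≥ 3`, every `ψ ∈ Ψ` (the hypothesis `ψ ∈ Ψ₁` of the typed statement is not
used) and every `s` on the segment `𝔍(−α)`:

* the exact (2.4) of the tree, `GammaFactor.Zfac_eq` — `Z(s,θ) = θ(−1)τ(θ)k^{−s}ϑ(s)(1 + r_θ)`,
  `|r_θ| ≤ 3e^{−πt}` for `t ≥ 1` (`GammaFactor.norm_corr_le`), `|(1 + r_θ)⁻¹ − 1| ≤ 6e^{−πt}`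
  (`GammaFactor.norm_inv_one_add_corr_sub_one_le`) — at `θ = ψ (mod p)` and `θ = χψ (mod Dp)`
  (`Skeleton.psiChi`, `Skeleton.Zpc`);
* the sign `(χψ)(−1) = χ(−1)ψ(−1)` (`Section4.psiChi_neg_one`);
* `τ(χψ) = τ(χ)τ(ψ)ψ(D)χ(p)` (`Z22:§15.u005`, the tree theorem `step15_u005_holds`, with `(D,p) = 1`
  because `p > D`, `Typed.Sec14.lt_of_mem_primeWindow`);
* `τ(χ)² = χ(−1)D` for the real primitive `χ` (`gaussSum_mul_gaussSum_inv` and `χ⁻¹ = χ`),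
  `χ(p)² = 1`, `ψ(D)ψ̄(D) = 1` (`p ∤ D`), so that
  `χ(−1)⁻¹τ(χ)⁻¹ψ(D)⁻¹χ(p)⁻¹D^{s} = τ(χ)χ(p)ψ̄(D)D^{s−1}` EXACTLY, the `O(e^{−πt})` being
  `(1 + r_ψ)(1 + r_{χψ})⁻¹ − 1`, of modulus `≤ 15e^{−πt}` once `t ≥ 1`;
* on `𝔍(−α)`, `t = Im s ≥ 2πt₀ − 𝓛₁ ≥ 1` (`t₀ = 𝓛⁵¹⁹`, `𝓛₁ = 𝓛⁴⁰⁵`, `𝓛 ≥ 1` for `D ≥ 3`).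

**Appended (revision 2): `Z22:§15.u004`** (§15 p. 80, tex L4017–L4020):

> Assume `ψ ∈ Ψ₁` and `s ∈ 𝔍(−α)`. By (2.2) and Lemma 5.1,
> `L(s+β₁,ψ)L(s+β₂,ψ)/L(s,ψ) = (pt₀)^{−β₃}Z(s,ψ) · L(1−s−β₁,ψ̄)L(1−s−β₂,ψ̄)/L(1−s,ψ̄) · (1 + O(𝓛⁻¹²³))`.

PROVED BY NAME as `step15_u004_holds : Step15_u004 c′` (every real `c′`; the constant and the
threshold `D₀` depend on `c′` and on Lemma 5.1's constant): the functional equation (2.2) of the tree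
(`GammaFactor.LFunction_eq_Zfac_mul`, from Mathlib's completed-`L` functional equation) at `s`, `s + β₁`,
`s + β₂`; Lemma 5.1 as landed (`Skeleton.lemma51_holds`: `Z(s+iv,ψ) = Z(s,ψ)(pt₀)^{−iv} + O(|v|𝓛⁻¹¹⁴)`
on `|Re s − ½| ≤ α`, `|Im s − 2πt₀| < 𝓛₁ + 2`, `0 < |v| < 𝓛²⁰`) at `iv = β₁, β₂` with `|β_j| ≤ 2(1+5|c′|)α`,
`α = π𝓛⁻⁹` (so `|v|𝓛⁻¹¹⁴ ≪ 𝓛⁻¹²³`); `β₁ + β₂ = β₃` ((2.13), so `(pt₀)^{−β₁}(pt₀)^{−β₂} = (pt₀)^{−β₃}`);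
and `|Z(s,ψ)|⁻¹ ≤ e¹⁶` near the critical line (`Typed.Section13.norm_inv_Zfac_le_exp_sixteen`), which
turns the absolute error of Lemma 5.1 into the printed relative one. Helpers: `five_mul_le_im_of_memJ`
(`Im s ≥ 5𝓛⁵¹⁹` on any `𝔍(z)`).

No new definitions, no named facts. Nothing about (15.4)/(15.6), Theorems 1–2 or Landau–Siegel zeros
is asserted here.

## References

* Y. Zhang, arXiv:2211.02515v1 (2022), §15 p. 80 (tex L4021–L4027); §2 (2.4)–(2.5) p. 4.
  [cite: Zhang2022LandauSiegel, §15 p. 80; §2 (2.4)–(2.5)]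
* H. L. Montgomery, R. C. Vaughan, *Multiplicative Number Theory I* (CUP 2007), Thm 9.6 (Gauss sums to
  coprime moduli), Thm 9.7 (`|τ(χ)| = √q`); Cor 10.9 (the asymmetric functional equation (2.2)).
  [cite: MontgomeryVaughan2007, Thm 9.6–9.7, Cor 10.9]
-/

noncomputable section

open Complex Real ComplexConjugate

namespace Literature.NumberTheory.LFunctions.Zhang2022.Typed.Section15A

open Literature.NumberTheory.LFunctions.Zhang2022.Skeleton

/-- `𝓛 = log D ≥ 1` for `D ≥ 3`. [cite: Zhang2022LandauSiegel, §2 (2.1)] -/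
private theorem one_le_ell_of_three_le_u006 {D : ℕ} (hD : 3 ≤ D) : 1 ≤ ell D := by
  have hD' : (3 : ℝ) ≤ D := by exact_mod_cast hD
  have h : (1 : ℝ) < Real.log 3 := by
    rw [Real.lt_log_iff_exp_lt (by norm_num)]
    exact Real.exp_one_lt_d9.trans (by norm_num)
  exact le_trans h.le (Real.log_le_log (by norm_num) hD')

/-- On a segment `𝔍(z)` (`|Im s − 2πt₀| ≤ 𝓛₁`, `t₀ = 𝓛⁵¹⁹`, `𝓛₁ = 𝓛⁴⁰⁵`), `t = Im s ≥ 1` once `D ≥ 3`.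
[cite: Zhang2022LandauSiegel, §7 p. 32] -/
theorem one_le_im_of_memJ {D : ℕ} (hD : 3 ≤ D) {z : ℝ} {s : ℂ} (hs : MemJ D z s) : 1 ≤ s.im := by
  have hL1 : 1 ≤ ell D := one_le_ell_of_three_le_u006 hD
  obtain ⟨-, him⟩ := hs
  have ht0 : t0 D = ell D ^ 519 := rfl
  have hell1 : ell1 D = ell D ^ 405 := rfl
  have h405 : ell D ^ 405 ≤ ell D ^ 519 := pow_le_pow_right₀ hL1 (by norm_num)
  have h519one : (1 : ℝ) ≤ ell D ^ 519 := one_le_pow₀ hL1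
  have hπ519 : 3 * ell D ^ 519 ≤ π * ell D ^ 519 :=
    mul_le_mul_of_nonneg_right Real.pi_gt_three.le (by linarith)
  have h1 := (abs_le.mp him).1
  rw [hell1, ht0] at h1
  linarith

/-- **`Z22:§15.u006` DISCHARGED** (§15 p. 80, tex L4025): for `D ≥ 3`, `ψ ∈ Ψ` (a fortiori `ψ ∈ Ψ₁`)
and `s ∈ 𝔍(−α)`, with `M = τ(χ)χ(p)ψ̄(D)D^{s−1}`,
`‖Z(s,ψ)/Z(s,χψ) − M‖ ≤ 15·e^{−πt}·‖M‖` (`t = Im s`) — the printed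
"`Z(s,ψ)/Z(s,χψ) = τ(χ)χ(p)ψ̄(D)D^{s−1}(1 + O(e^{−πt}))`", from the exact (2.4) (`GammaFactor.Zfac_eq`)
at `θ = ψ` and `θ = χψ`, `τ(χψ) = τ(χ)τ(ψ)ψ(D)χ(p)` (`step15_u005_holds`), `τ(χ)² = χ(−1)D`, `χ(p)² = 1`,
`|ψ(D)| = 1`. [cite: Zhang2022LandauSiegel, §15 p. 80] -/
theorem step15_u006_holds : Step15_u006 := by
  refine ⟨15, ForAllLarge.of_le 3 fun D _ χ hD hq hχ x _ s hs => ?_⟩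
  intro M
  have hM : M = GammaFactor.tau χ * χ (x.p : ZMod D) * conj (x.ψ (D : ZMod x.p)) *
      (D : ℂ) ^ (s - 1) := rfl
  -- sizes of `t`, `D`, `p`
  have ht1 : 1 ≤ s.im := one_le_im_of_memJ hD hs
  have hspos : 0 < s.im := by linarith
  have hD0 : (D : ℂ) ≠ 0 := Nat.cast_ne_zero.mpr (by omega)
  have hp0 : (x.p : ℂ) ≠ 0 := Nat.cast_ne_zero.mpr x.prime.ne_zero
  have hDp : D < x.p := Typed.Sec14.lt_of_mem_primeWindow hD x.mem
  have hcopPD : Nat.Coprime x.p D :=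
    (Nat.Prime.coprime_iff_not_dvd x.prime).mpr fun h => by
      have := Nat.le_of_dvd (by omega) h; omega
  have hcop : Nat.Coprime D x.p := hcopPD.symm
  -- the exact (2.4) for `ψ` and for `χψ`
  have hZψ := GammaFactor.Zfac_eq x.ψ hspos
  have hZθ : Zpc χ x s = (psiChi χ x) (-1) * GammaFactor.tau (psiChi χ x) *
      ((D * x.p : ℕ) : ℂ) ^ (-s) * GammaFactor.vartheta s * (1 + GammaFactor.corr (psiChi χ x) s) :=
    GammaFactor.Zfac_eq (psiChi χ x) hspos
  have hsign : (psiChi χ x) (-1) = χ (-1) * x.ψ (-1) := Section4.psiChi_neg_one χ x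
  have hτ : GammaFactor.tau (psiChi χ x) =
      GammaFactor.tau χ * GammaFactor.tau x.ψ * x.ψ (D : ZMod x.p) * χ (x.p : ZMod D) :=
    step15_u005_holds D χ x hcop
  -- `(Dp)^{−s} = D^{−s} p^{−s}`
  have hpow : ((D * x.p : ℕ) : ℂ) ^ (-s) = (D : ℂ) ^ (-s) * (x.p : ℂ) ^ (-s) := by
    have e1 : ((x.p : ℕ) : ℂ) = ((x.p : ℝ) : ℂ) := (Complex.ofReal_natCast x.p).symm
    have e0 : ((D : ℕ) : ℂ) = ((D : ℝ) : ℂ) := (Complex.ofReal_natCast D).symm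
    have e2 : ((D * x.p : ℕ) : ℂ) = ((D : ℝ) : ℂ) * ((x.p : ℝ) : ℂ) := by push_cast; ring
    rw [e2, e0, e1, Complex.mul_cpow_ofReal_nonneg (Nat.cast_nonneg D) (Nat.cast_nonneg x.p)]
  -- non-vanishing of the factors of `Z(s,χψ)`
  set r₁ : ℂ := GammaFactor.corr x.ψ s with hr₁
  set r₂ : ℂ := GammaFactor.corr (psiChi χ x) s with hr₂
  have hr₂ne : 1 + r₂ ≠ 0 := GammaFactor.one_add_corr_ne_zero (psiChi χ x) hspos
  -- the algebraic identities `τ(χ)² = χ(−1)D`, `χ(−1)² = 1`, `χ(p)² = 1`, `ψ̄(D)ψ(D) = 1`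
  have hττ : GammaFactor.tau χ * GammaFactor.tau χ = χ (-1) * D := by
    have h := Literature.NumberTheory.LFunctions.gaussSum_mul_gaussSum_inv χ hχ
    rw [MulChar.IsQuadratic.inv hq] at h
    exact h
  have hχχ : χ (-1) * χ (-1) = 1 := by
    rw [← map_mul, neg_mul_neg, one_mul, map_one]
  have hχp : χ (x.p : ZMod D) * χ (x.p : ZMod D) = 1 := by
    have hu : IsUnit (x.p : ZMod D) := (ZMod.isUnit_iff_coprime x.p D).mpr hcopPD
    have hne : χ (x.p : ZMod D) ≠ 0 := (hu.map χ).ne_zero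
    rcases hq (x.p : ZMod D) with h | h | h
    · exact absurd h hne
    · rw [h, one_mul]
    · rw [h]; norm_num
  have hψD : conj (x.ψ (D : ZMod x.p)) * x.ψ (D : ZMod x.p) = 1 := by
    have hu : IsUnit (D : ZMod x.p) := (ZMod.isUnit_iff_coprime D x.p).mpr hcop
    have hn : ‖x.ψ (D : ZMod x.p)‖ = 1 := by
      have := DirichletCharacter.unit_norm_eq_one x.ψ hu.unit
      rwa [IsUnit.unit_spec] at this
    have hne : x.ψ (D : ZMod x.p) ≠ 0 := by
      intro h; rw [h, norm_zero] at hn; exact zero_ne_one hn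
    rw [← Complex.inv_eq_conj hn, inv_mul_cancel₀ hne]
  have hDpow : (D : ℂ) ^ (s - 1) * (D : ℂ) ^ (-s) = (D : ℂ)⁻¹ := by
    rw [← cpow_add _ _ hD0, show s - 1 + -s = (-1 : ℂ) by ring, cpow_neg_one]
  -- `M · (χ(−1)τ(χ)ψ(D)χ(p)D^{−s}) = 1`
  have hMinv : M * (χ (-1) * GammaFactor.tau χ * x.ψ (D : ZMod x.p) * χ (x.p : ZMod D) *
      (D : ℂ) ^ (-s)) = 1 := by
    rw [hM]
    calc GammaFactor.tau χ * χ (x.p : ZMod D) * conj (x.ψ (D : ZMod x.p)) * (D : ℂ) ^ (s - 1) *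
          (χ (-1) * GammaFactor.tau χ * x.ψ (D : ZMod x.p) * χ (x.p : ZMod D) * (D : ℂ) ^ (-s))
        = (GammaFactor.tau χ * GammaFactor.tau χ) * (χ (x.p : ZMod D) * χ (x.p : ZMod D)) *
            (conj (x.ψ (D : ZMod x.p)) * x.ψ (D : ZMod x.p)) * χ (-1) *
            ((D : ℂ) ^ (s - 1) * (D : ℂ) ^ (-s)) := by ring
      _ = χ (-1) * D * 1 * 1 * χ (-1) * (D : ℂ)⁻¹ := by rw [hττ, hχp, hψD, hDpow]
      _ = (χ (-1) * χ (-1)) * ((D : ℂ) * (D : ℂ)⁻¹) := by ring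
      _ = 1 := by rw [hχχ, mul_inv_cancel₀ hD0, one_mul]
  -- `Z(s,χψ) ≠ 0`
  have hZθne : Zpc χ x s ≠ 0 := by
    rw [hZθ, hsign, hτ, hpow]
    have hτχ : GammaFactor.tau χ ≠ 0 := GammaFactor.tau_ne_zero hχ
    have hτψ : GammaFactor.tau x.ψ ≠ 0 := GammaFactor.tau_ne_zero x.prim
    have hχ1 : χ (-1) ≠ 0 := fun h => by rw [h, zero_mul] at hχχ; exact zero_ne_one hχχ
    have hψ1 : x.ψ (-1) ≠ 0 := fun h => by
      have hψψ : x.ψ (-1) * x.ψ (-1) = 1 := by rw [← map_mul, neg_mul_neg, one_mul, map_one]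
      rw [h, zero_mul] at hψψ; exact zero_ne_one hψψ
    have hψD' : x.ψ (D : ZMod x.p) ≠ 0 := fun h => by
      rw [h, mul_zero] at hψD; exact zero_ne_one hψD
    have hχp' : χ (x.p : ZMod D) ≠ 0 := fun h => by
      rw [h, mul_zero] at hχp; exact zero_ne_one hχp
    have hDs : (D : ℂ) ^ (-s) ≠ 0 := by
      rw [Ne, Complex.cpow_eq_zero_iff, not_and_or]; exact Or.inl hD0
    have hps : (x.p : ℂ) ^ (-s) ≠ 0 := by
      rw [Ne, Complex.cpow_eq_zero_iff, not_and_or]; exact Or.inl hp0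
    have hϑ : GammaFactor.vartheta s ≠ 0 :=
      GammaFactor.vartheta_ne_zero (ChiStirling.sin_pi_mul_ne_zero hspos.ne')
    simp only [ne_eq, mul_eq_zero, hτχ, hτψ, hχ1, hψ1, hψD', hχp', hDs, hps, hϑ, hr₂ne, or_self,
      not_false_eq_true]
  -- the exact ratio: `Z(s,ψ)/Z(s,χψ) = M · (1 + r_ψ)(1 + r_{χψ})⁻¹`
  have hratio : GammaFactor.Zfac x.ψ s / Zpc χ x s = M * ((1 + r₁) * (1 + r₂)⁻¹) := by
    rw [div_eq_iff hZθne, hZθ, hsign, hτ, hpow, hZψ]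
    symm
    calc M * ((1 + r₁) * (1 + r₂)⁻¹) *
          (χ (-1) * x.ψ (-1) *
            (GammaFactor.tau χ * GammaFactor.tau x.ψ * x.ψ (D : ZMod x.p) * χ (x.p : ZMod D)) *
            ((D : ℂ) ^ (-s) * (x.p : ℂ) ^ (-s)) * GammaFactor.vartheta s * (1 + r₂))
        = (M * (χ (-1) * GammaFactor.tau χ * x.ψ (D : ZMod x.p) * χ (x.p : ZMod D) *
            (D : ℂ) ^ (-s))) * ((1 + r₂)⁻¹ * (1 + r₂)) *
            (x.ψ (-1) * GammaFactor.tau x.ψ * (x.p : ℂ) ^ (-s) * GammaFactor.vartheta s *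
              (1 + r₁)) := by ring
      _ = x.ψ (-1) * GammaFactor.tau x.ψ * (x.p : ℂ) ^ (-s) * GammaFactor.vartheta s *
            (1 + r₁) := by rw [hMinv, inv_mul_cancel₀ hr₂ne, one_mul, one_mul]
  -- the `O(e^{−πt})`: `|(1 + r₁)(1 + r₂)⁻¹ − 1| ≤ 15e^{−πt}`
  have h1 : ‖r₁‖ ≤ 3 * Real.exp (-π * s.im) := GammaFactor.norm_corr_le x.ψ ht1
  have h2 : ‖(1 + r₂)⁻¹ - 1‖ ≤ 6 * Real.exp (-π * s.im) :=
    GammaFactor.norm_inv_one_add_corr_sub_one_le (psiChi χ x) ht1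
  have he3 : Real.exp (-π * s.im) ≤ 1 / 3 := GammaFactor.exp_neg_pi_mul_le ht1
  have he0 : 0 ≤ Real.exp (-π * s.im) := (Real.exp_pos _).le
  have hcorr : ‖(1 + r₁) * (1 + r₂)⁻¹ - 1‖ ≤ 15 * Real.exp (-π * s.im) := by
    have hexpand : (1 + r₁) * (1 + r₂)⁻¹ - 1 = r₁ * ((1 + r₂)⁻¹ - 1) + r₁ + ((1 + r₂)⁻¹ - 1) := by
      ring
    rw [hexpand]
    calc ‖r₁ * ((1 + r₂)⁻¹ - 1) + r₁ + ((1 + r₂)⁻¹ - 1)‖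
        ≤ ‖r₁‖ * ‖(1 + r₂)⁻¹ - 1‖ + ‖r₁‖ + ‖(1 + r₂)⁻¹ - 1‖ := by
          calc ‖r₁ * ((1 + r₂)⁻¹ - 1) + r₁ + ((1 + r₂)⁻¹ - 1)‖
              ≤ ‖r₁ * ((1 + r₂)⁻¹ - 1) + r₁‖ + ‖(1 + r₂)⁻¹ - 1‖ := norm_add_le _ _
            _ ≤ ‖r₁ * ((1 + r₂)⁻¹ - 1)‖ + ‖r₁‖ + ‖(1 + r₂)⁻¹ - 1‖ := by
                gcongr; exact norm_add_le _ _
            _ ≤ ‖r₁‖ * ‖(1 + r₂)⁻¹ - 1‖ + ‖r₁‖ + ‖(1 + r₂)⁻¹ - 1‖ := by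
                gcongr; exact norm_mul_le _ _
      _ ≤ 3 * Real.exp (-π * s.im) * (6 * Real.exp (-π * s.im)) + 3 * Real.exp (-π * s.im) +
            6 * Real.exp (-π * s.im) := by
          gcongr
      _ ≤ 15 * Real.exp (-π * s.im) := by nlinarith
  rw [hratio, show M * ((1 + r₁) * (1 + r₂)⁻¹) - M = M * ((1 + r₁) * (1 + r₂)⁻¹ - 1) by ring,
    norm_mul]
  calc ‖M‖ * ‖(1 + r₁) * (1 + r₂)⁻¹ - 1‖ ≤ ‖M‖ * (15 * Real.exp (-π * s.im)) :=
        mul_le_mul_of_nonneg_left hcorr (norm_nonneg _)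
    _ = 15 * Real.exp (-π * s.im) * ‖M‖ := by ring

/-! ## `Z22:§15.u004`: the reflected triple `L`-quotient on `𝔍(−α)` (appended, revision 2) -/

/-- `L₀ ≤ log D` once `D ≥ ⌈exp L₀⌉₊`. [folklore] -/
private theorem le_ell_of_ceil_exp_le {L₀ : ℝ} {D : ℕ} (hD : ⌈Real.exp L₀⌉₊ ≤ D) :
    L₀ ≤ ell D := by
  have h : Real.exp L₀ ≤ D := le_trans (Nat.le_ceil _) (by exact_mod_cast hD)
  exact (Real.le_log_iff_exp_le (lt_of_lt_of_le (Real.exp_pos _) h)).mpr h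

/-- On a segment `𝔍(z)`: `Im s ≥ 2πt₀ − 𝓛₁ ≥ 5𝓛⁵¹⁹` once `𝓛 ≥ 1`. [cite: Zhang2022LandauSiegel, §7 p. 32] -/
theorem five_mul_le_im_of_memJ {D : ℕ} (hL : 1 ≤ ell D) {z : ℝ} {s : ℂ} (hs : MemJ D z s) :
    5 * ell D ^ 519 ≤ s.im := by
  obtain ⟨-, him⟩ := hs
  have ht0 : t0 D = ell D ^ 519 := rfl
  have hell1 : ell1 D = ell D ^ 405 := rfl
  have h405 : ell D ^ 405 ≤ ell D ^ 519 := pow_le_pow_right₀ hL (by norm_num)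
  have h519 : (0 : ℝ) ≤ ell D ^ 519 := by positivity
  have hπ519 : 3 * ell D ^ 519 ≤ π * ell D ^ 519 :=
    mul_le_mul_of_nonneg_right Real.pi_gt_three.le h519
  have h1 := (abs_le.mp him).1
  rw [hell1, ht0] at h1
  linarith

/-- `|(pt₀)^{−ib}| = 1` (`pt₀ > 0`, purely imaginary exponent). [folklore] -/
private theorem norm_base_cpow_eq_one {D : ℕ} (x : Chr D) (hL : 0 < ell D) (b : ℝ) :
    ‖(((x.p : ℝ) * t0 D : ℝ) : ℂ) ^ (-((b : ℂ) * I))‖ = 1 := by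
  have hpt : 0 < (x.p : ℝ) * t0 D := by
    have hp : (0 : ℝ) < x.p := by exact_mod_cast x.prime.pos
    have ht : 0 < t0 D := by rw [show t0 D = ell D ^ 519 from rfl]; positivity
    exact mul_pos hp ht
  rw [Complex.norm_cpow_eq_rpow_re_of_pos hpt]
  simp

/-- **`Z22:§15.u004` DISCHARGED** (§15 p. 80, tex L4017): for `ψ ∈ Ψ` (a fortiori `ψ ∈ Ψ₁`) and
`s ∈ 𝔍(−α)`, with `M = (pt₀)^{−β₃}Z(s,ψ)·L(1−s−β₁,ψ̄)L(1−s−β₂,ψ̄)/L(1−s,ψ̄)`,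
`‖L(s+β₁,ψ)L(s+β₂,ψ)/L(s,ψ) − M‖ ≤ C·𝓛⁻¹²³·‖M‖` — the printed "By (2.2) and Lemma 5.1,
`L(s+β₁,ψ)L(s+β₂,ψ)/L(s,ψ) = (pt₀)^{−β₃}Z(s,ψ)·L(1−s−β₁,ψ̄)L(1−s−β₂,ψ̄)/L(1−s,ψ̄)·(1 + O(𝓛⁻¹²³))`":
the functional equation (2.2) (`GammaFactor.LFunction_eq_Zfac_mul`) at `s`, `s+β₁`, `s+β₂`; Lemma 5.1
(`lemma51_holds`: `Z(s+iv,ψ) = Z(s,ψ)(pt₀)^{−iv} + O(|v|𝓛⁻¹¹⁴)`) at `iv = β₁, β₂` (`|β_j| ≪_{c′} α =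
π𝓛⁻⁹`); `β₁ + β₂ = β₃` (2.13); and `|Z(s,ψ)|⁻¹ ≤ e¹⁶` near the critical line
(`Typed.Section13.norm_inv_Zfac_le_exp_sixteen`). The constant depends on `c′` and on Lemma 5.1's.
[cite: Zhang2022LandauSiegel, §15 p. 80] -/
theorem step15_u004_holds (c' : ℝ) : Step15_u004 c' := by
  obtain ⟨C, D₅₁, h51⟩ := lemma51_holds
  set C₀ : ℝ := max C 0 with hC₀
  set K : ℝ := 2 * (1 + 5 * |c'|) with hK
  set A : ℝ := Real.exp 16 * C₀ * K * π with hA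
  refine ⟨2 * A + A ^ 2,
    ForAllLarge.of_le (max D₅₁ ⌈Real.exp (K * π + 4)⌉₊) fun D _ χ hD hq hχ x _ s hs => ?_⟩
  intro M
  have hM : M = (((x.p : ℝ) * t0 D : ℝ) : ℂ) ^ (-beta3 c' D) * GammaFactor.Zfac x.ψ s *
      (x.ψ⁻¹.LFunction (1 - s - beta1 c' D) * x.ψ⁻¹.LFunction (1 - s - beta2 c' D) /
        x.ψ⁻¹.LFunction (1 - s)) := rfl
  -- sizes of the parameters
  have hD₅₁ : D₅₁ ≤ D := le_trans (le_max_left _ _) hD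
  have hLK : K * π + 4 ≤ ell D := le_ell_of_ceil_exp_le (le_trans (le_max_right _ _) hD)
  have hK2 : 2 ≤ K := by rw [hK]; linarith [abs_nonneg c']
  have hKπ : 0 ≤ K * π := by positivity
  have hL4 : 4 ≤ ell D := by linarith
  have hL3 : 3 ≤ ell D := by linarith
  have hL1 : 1 ≤ ell D := by linarith
  have hL0 : 0 < ell D := by linarith
  have hC₀0 : 0 ≤ C₀ := le_max_right _ _
  have hCC₀ : C ≤ C₀ := le_max_left _ _
  have hA0 : 0 ≤ A := by rw [hA]; positivity
  have hα : 0 < alpha D := alpha_pos' hL0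
  have hαeq : alpha D = π / ell D ^ 9 := by rw [alpha, bigP, Real.log_exp]
  have hαℓ : alpha D * ell D ≤ 1 := alpha_mul_ell_le_one (by linarith)
  have hαπ : alpha D ≤ π := by
    rw [hαeq]
    exact div_le_self Real.pi_pos.le (one_le_pow₀ hL1)
  have hKα : K * alpha D < ell D := by
    calc K * alpha D ≤ K * π := mul_le_mul_of_nonneg_left hαπ (by linarith)
      _ < ell D := by linarith
  -- the segment: `Re s = 1/2 − α`, `Im s ≥ 5𝓛⁵¹⁹`
  have hre : s.re = 1 / 2 + -alpha D := hs.1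
  have himJ : |s.im - 2 * π * t0 D| ≤ ell1 D := hs.2
  have him5 : 5 * ell D ^ 519 ≤ s.im := five_mul_le_im_of_memJ hL1 hs
  have h519 : ell D ≤ ell D ^ 519 := le_self_pow₀ hL1 (by norm_num)
  have hspos : 0 < s.im := by linarith
  have hR51 : InRange51 D s := by
    refine ⟨?_, ?_⟩
    · rw [hre, show 1 / 2 + -alpha D - 1 / 2 = -alpha D by ring, abs_neg, abs_of_pos hα]
    · have : ell1 D < ell1 D + 2 := by linarith
      exact lt_of_le_of_lt himJ this
  -- the two shift sizes `b₁, b₂` (`β_j = i b_j`), `|b_j| ≤ Kα`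
  set b₁ : ℝ := alpha D * (1 - 5 * c' * alpha D * ell D) with hb₁
  set b₂ : ℝ := 2 * alpha D * (1 + c' * alpha D * ell D) with hb₂
  have hβ₁ : beta1 c' D = (b₁ : ℂ) * I := by simp only [beta1, hb₁]; push_cast; ring
  have hβ₂ : beta2 c' D = (b₂ : ℂ) * I := by simp only [beta2, hb₂]; push_cast; ring
  have hβ₃ : beta3 c' D = (b₁ : ℂ) * I + (b₂ : ℂ) * I := by
    simp only [beta3, hb₁, hb₂]; push_cast; ring
  have hcαℓ : |c' * alpha D * ell D| ≤ |c'| := by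
    rw [mul_assoc, abs_mul]
    calc |c'| * |alpha D * ell D| ≤ |c'| * 1 := by
          refine mul_le_mul_of_nonneg_left ?_ (abs_nonneg _)
          rw [abs_of_nonneg (by positivity)]; exact hαℓ
      _ = |c'| := mul_one _
  have hb₁K : |b₁| ≤ K * alpha D := by
    rw [hb₁, abs_mul, abs_of_pos hα]
    have h1 : |1 - 5 * c' * alpha D * ell D| ≤ 1 + 5 * |c'| := by
      calc |1 - 5 * c' * alpha D * ell D| ≤ |(1 : ℝ)| + |5 * c' * alpha D * ell D| := abs_sub _ _
        _ = 1 + 5 * |c' * alpha D * ell D| := by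
            rw [abs_one, show 5 * c' * alpha D * ell D = 5 * (c' * alpha D * ell D) by ring,
              abs_mul, abs_of_pos (by norm_num : (0:ℝ) < 5)]
        _ ≤ 1 + 5 * |c'| := by linarith
    calc alpha D * |1 - 5 * c' * alpha D * ell D| ≤ alpha D * (1 + 5 * |c'|) :=
          mul_le_mul_of_nonneg_left h1 hα.le
      _ ≤ K * alpha D := by
          rw [hK, show 2 * (1 + 5 * |c'|) * alpha D
              = alpha D * (1 + 5 * |c'|) + alpha D * (1 + 5 * |c'|) by ring]
          have h0 : 0 ≤ alpha D * (1 + 5 * |c'|) := by positivity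
          linarith
  have hb₂K : |b₂| ≤ K * alpha D := by
    rw [hb₂, abs_mul, abs_mul, abs_of_pos hα, abs_of_pos (by norm_num : (0:ℝ) < 2)]
    have h1 : |1 + c' * alpha D * ell D| ≤ 1 + |c'| := by
      calc |1 + c' * alpha D * ell D| ≤ |(1 : ℝ)| + |c' * alpha D * ell D| := abs_add_le _ _
        _ ≤ 1 + |c'| := by rw [abs_one]; linarith
    calc 2 * alpha D * |1 + c' * alpha D * ell D| ≤ 2 * alpha D * (1 + |c'|) :=
          mul_le_mul_of_nonneg_left h1 (by positivity)
      _ ≤ K * alpha D := by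
          rw [hK, show 2 * (1 + 5 * |c'|) * alpha D
              = 2 * alpha D * (1 + |c'|) + 8 * (alpha D * |c'|) by ring]
          have h0 : 0 ≤ alpha D * |c'| := by positivity
          linarith
  -- Lemma 5.1 at `iv = ib`, `|b| ≤ Kα`: `‖Z(s+ib) − Z(s)(pt₀)^{−ib}‖ ≤ C₀𝓛⁻¹¹⁴|b|`
  set base : ℂ := (((x.p : ℝ) * t0 D : ℝ) : ℂ) with hbase
  set Z : ℂ := GammaFactor.Zfac x.ψ s with hZ
  have hshift : ∀ b : ℝ, |b| ≤ K * alpha D →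
      ‖GammaFactor.Zfac x.ψ (s + b * I) - Z * base ^ (-((b : ℂ) * I))‖ ≤
        C₀ * (ell D ^ 114)⁻¹ * |b| := by
    intro b hb
    rcases eq_or_ne b 0 with hb0 | hb0
    · subst hb0
      simp [hZ]
    · have hb20 : |b| < ell D ^ 20 := by
        calc |b| ≤ K * alpha D := hb
          _ < ell D := hKα
          _ ≤ ell D ^ 20 := le_self_pow₀ hL1 (by norm_num)
      have h := (h51 D χ hD₅₁ hq hχ x s hR51 b hb0 hb20).1
      have hbI : (b : ℂ) * I ≠ 0 := mul_ne_zero (Complex.ofReal_ne_zero.mpr hb0) Complex.I_ne_zero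
      have hbIn : ‖(b : ℂ) * I‖ = |b| := by
        rw [norm_mul, Complex.norm_I, mul_one, Complex.norm_real, Real.norm_eq_abs]
      rw [norm_div, hbIn, div_le_iff₀ (abs_pos.mpr hb0)] at h
      calc ‖GammaFactor.Zfac x.ψ (s + b * I) - Z * base ^ (-((b : ℂ) * I))‖
          ≤ C * (ell D ^ 114)⁻¹ * |b| := h
        _ ≤ C₀ * (ell D ^ 114)⁻¹ * |b| := by gcongr
  -- `Z(s,ψ) ≠ 0`, `|Z(s,ψ)|⁻¹ ≤ e¹⁶`, `|(pt₀)^{−ib}| = 1`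
  have hZne : Z ≠ 0 := GammaFactor.Zfac_ne_zero x.prim hspos
  have hZinv : ‖Z⁻¹‖ ≤ Real.exp 16 := by
    have hσ : |s.re - 1 / 2| ≤ 2 * alpha D := by
      rw [hre, show 1 / 2 + -alpha D - 1 / 2 = -alpha D by ring, abs_neg, abs_of_pos hα]
      linarith
    have ht : |s.im - 2 * π * ell D ^ 519| < ell D ^ 405 + 2 := by
      have e1 : t0 D = ell D ^ 519 := rfl
      have e2 : ell1 D = ell D ^ 405 := rfl
      rw [e1, e2] at himJ
      linarith
    have h := Typed.Section13.norm_inv_Zfac_le_exp_sixteen x hL3 hσ ht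
    rwa [Complex.re_add_im] at h
  have hu1 : ∀ b : ℝ, ‖base ^ (-((b : ℂ) * I))‖ = 1 := fun b => norm_base_cpow_eq_one x hL0 b
  have hune : ∀ b : ℝ, base ^ (-((b : ℂ) * I)) ≠ 0 := fun b h => by
    have := hu1 b; rw [h, norm_zero] at this; exact zero_ne_one this
  -- the relative errors `ε_j`: `Z(s+β_j) = Z(s)(pt₀)^{−β_j}(1 + ε_j)`, `|ε_j| ≤ A𝓛⁻¹²³`
  have hrel : ∀ b : ℝ, |b| ≤ K * alpha D →
      ∃ ε : ℂ, GammaFactor.Zfac x.ψ (s + b * I) = Z * base ^ (-((b : ℂ) * I)) * (1 + ε) ∧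
        ‖ε‖ ≤ A * (ell D ^ 123)⁻¹ := by
    intro b hb
    set u : ℂ := base ^ (-((b : ℂ) * I)) with hu
    have hZu : Z * u ≠ 0 := mul_ne_zero hZne (hune b)
    refine ⟨(GammaFactor.Zfac x.ψ (s + b * I) - Z * u) / (Z * u), ?_, ?_⟩
    · rw [mul_add, mul_one, mul_div_assoc', mul_div_cancel_left₀ _ hZu]
      ring
    · rw [norm_div, norm_mul, hu1 b, mul_one, div_eq_mul_inv, ← norm_inv]
      have h1 := hshift b hb
      calc ‖GammaFactor.Zfac x.ψ (s + b * I) - Z * u‖ * ‖Z⁻¹‖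
          ≤ (C₀ * (ell D ^ 114)⁻¹ * |b|) * Real.exp 16 :=
            mul_le_mul h1 hZinv (norm_nonneg _) (by positivity)
        _ ≤ (C₀ * (ell D ^ 114)⁻¹ * (K * alpha D)) * Real.exp 16 := by gcongr
        _ = A * (ell D ^ 123)⁻¹ := by
            rw [hA, hαeq]
            field_simp
  obtain ⟨ε₁, hZ₁, hε₁⟩ := hrel b₁ hb₁K
  obtain ⟨ε₂, hZ₂, hε₂⟩ := hrel b₂ hb₂K
  -- the functional equation (2.2) at `s`, `s + β₁`, `s + β₂`
  have himb : ∀ b : ℝ, |b| ≤ K * alpha D → (s + b * I).im ≠ 0 := by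
    intro b hb
    have : (s + b * I).im = s.im + b := by simp
    rw [this]
    have hb' := (abs_le.mp hb).1
    exact ne_of_gt (by linarith)
  have hFE0 : x.ψ.LFunction s = Z * x.ψ⁻¹.LFunction (1 - s) :=
    GammaFactor.LFunction_eq_Zfac_mul x.prim x.p_ne_one hspos.ne'
  have hFE1 : x.ψ.LFunction (s + beta1 c' D) =
      GammaFactor.Zfac x.ψ (s + b₁ * I) * x.ψ⁻¹.LFunction (1 - s - beta1 c' D) := by
    rw [hβ₁, GammaFactor.LFunction_eq_Zfac_mul x.prim x.p_ne_one (himb b₁ hb₁K),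
      show (1 : ℂ) - (s + b₁ * I) = 1 - s - b₁ * I by ring]
  have hFE2 : x.ψ.LFunction (s + beta2 c' D) =
      GammaFactor.Zfac x.ψ (s + b₂ * I) * x.ψ⁻¹.LFunction (1 - s - beta2 c' D) := by
    rw [hβ₂, GammaFactor.LFunction_eq_Zfac_mul x.prim x.p_ne_one (himb b₂ hb₂K),
      show (1 : ℂ) - (s + b₂ * I) = 1 - s - b₂ * I by ring]
  -- `(pt₀)^{−β₁}(pt₀)^{−β₂} = (pt₀)^{−β₃}`
  have hbase0 : base ≠ 0 := by
    rw [hbase]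
    have hp : (0 : ℝ) < x.p := by exact_mod_cast x.prime.pos
    have ht : 0 < t0 D := by rw [show t0 D = ell D ^ 519 from rfl]; positivity
    exact Complex.ofReal_ne_zero.mpr (mul_pos hp ht).ne'
  have hu12 : base ^ (-((b₁ : ℂ) * I)) * base ^ (-((b₂ : ℂ) * I)) = base ^ (-beta3 c' D) := by
    rw [← Complex.cpow_add _ _ hbase0, hβ₃]
    congr 1
    ring
  -- the exact identity `LHS = M·(1 + ε₁)(1 + ε₂)`
  set L' : ℂ := x.ψ⁻¹.LFunction (1 - s) with hL'
  set L₁ : ℂ := x.ψ⁻¹.LFunction (1 - s - beta1 c' D) with hL₁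
  set L₂ : ℂ := x.ψ⁻¹.LFunction (1 - s - beta2 c' D) with hL₂
  have hLHS : x.ψ.LFunction (s + beta1 c' D) * x.ψ.LFunction (s + beta2 c' D) / x.ψ.LFunction s =
      M * ((1 + ε₁) * (1 + ε₂)) := by
    rw [hFE1, hFE2, hFE0, hZ₁, hZ₂, hM]
    rw [show Z * base ^ (-((b₁ : ℂ) * I)) * (1 + ε₁) * L₁ * (Z * base ^ (-((b₂ : ℂ) * I)) * (1 + ε₂) * L₂)
        = Z * (Z * (base ^ (-((b₁ : ℂ) * I)) * base ^ (-((b₂ : ℂ) * I))) * ((1 + ε₁) * (1 + ε₂)) *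
          (L₁ * L₂)) by ring, mul_div_mul_left _ _ hZne, hu12]
    ring
  -- the `O(𝓛⁻¹²³)`
  have hL123 : (ell D ^ 123)⁻¹ ≤ 1 := inv_le_one_of_one_le₀ (one_le_pow₀ hL1)
  have hL123pos : 0 ≤ (ell D ^ 123)⁻¹ := by positivity
  have hcorr : ‖(1 + ε₁) * (1 + ε₂) - 1‖ ≤ (2 * A + A ^ 2) * (ell D ^ 123)⁻¹ := by
    have hexpand : (1 + ε₁) * (1 + ε₂) - 1 = ε₁ + ε₂ + ε₁ * ε₂ := by ring
    rw [hexpand]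
    calc ‖ε₁ + ε₂ + ε₁ * ε₂‖ ≤ ‖ε₁‖ + ‖ε₂‖ + ‖ε₁‖ * ‖ε₂‖ := by
          calc ‖ε₁ + ε₂ + ε₁ * ε₂‖ ≤ ‖ε₁ + ε₂‖ + ‖ε₁ * ε₂‖ := norm_add_le _ _
            _ ≤ ‖ε₁‖ + ‖ε₂‖ + ‖ε₁‖ * ‖ε₂‖ := by
                gcongr
                · exact norm_add_le _ _
                · exact norm_mul_le _ _
      _ ≤ A * (ell D ^ 123)⁻¹ + A * (ell D ^ 123)⁻¹ +
            A * (ell D ^ 123)⁻¹ * (A * (ell D ^ 123)⁻¹) := by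
          gcongr
      _ = (2 * A + A ^ 2 * (ell D ^ 123)⁻¹) * (ell D ^ 123)⁻¹ := by ring
      _ ≤ (2 * A + A ^ 2) * (ell D ^ 123)⁻¹ := by
          have hq : A ^ 2 * (ell D ^ 123)⁻¹ ≤ A ^ 2 := mul_le_of_le_one_right (sq_nonneg A) hL123
          have hq' : 2 * A + A ^ 2 * (ell D ^ 123)⁻¹ ≤ 2 * A + A ^ 2 := by linarith
          exact mul_le_mul_of_nonneg_right hq' hL123pos
  rw [hLHS, show M * ((1 + ε₁) * (1 + ε₂)) - M = M * ((1 + ε₁) * (1 + ε₂) - 1) by ring, norm_mul]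
  calc ‖M‖ * ‖(1 + ε₁) * (1 + ε₂) - 1‖ ≤ ‖M‖ * ((2 * A + A ^ 2) * (ell D ^ 123)⁻¹) :=
        mul_le_mul_of_nonneg_left hcorr (norm_nonneg _)
    _ = (2 * A + A ^ 2) * (ell D ^ 123)⁻¹ * ‖M‖ := by ring

end Literature.NumberTheory.LFunctions.Zhang2022.Typed.Section15A
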